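import Summits.BirchSwinnertonDyer.Rank1Residual.AdditivePotMult.QuadraticBaseChangeThetaModel
import Summits.BirchSwinnertonDyer.Rank1Residual.AdditivePotMult.QuadraticBaseChangeDescentRankLeOneEach
import HarnessLib

/-!
# The base-change-and-descend ENDs in Dokchitser–Dokchitser's MODEL-FREE currency
# `MissingPPartOverCAt (W.baseChange K) p` — NO Milne, NO globally minimal `K`-model
# (row T-MIL-UNI, FILE U-2; seat n1011-p01 GEN 10)

HONEST FRAMING (cell `b2b-bsdres`, run/shared/lean/b2b/bsd-rank1-residual/, verbatim in every
file): the goal of the cell is to DELETE the COMBINATION-SHAPED residual classes of the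
Birch–Swinnerton-Dyer formula for ALL analytic-rank `≤ 1` elliptic curves over `ℚ` — "full BSD
formula for every rank `≤ 1` curve in class `C`" assembled STRICTLY from published theorems — so
that the rank-`≤ 1` remainder becomes exactly the CONSTRUCTION-SHAPED classes, which are TYPED
(missing-input `Prop`s), NOT attempted. This is not "finishing BSD". Sub-classes X3♯(M) / X4(M)
(additive, potentially multiplicative prime; base-change-and-descend): a RESEARCH ROUTE; they stay
CONSTRUCTION-SHAPED; nothing is booked by this file; no mark / label moved. THEOREMS ONLY: no
definition, no named fact, no `sorry`.

## What (row T-MIL-UNI, `cells/n1011/skel/T-MIL-UNI.md` §0 (c), FILE U-2)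

FILE J-3's ENDs (`…_of_dvd_discr_bothLeOne` and the canonical-field / class twins) with the binders
`{W', hW' : C' • W_K = W', hK : MissingPPartOverAt W' p}` REPLACED by the single model-free binder
`hK : MissingPPartOverCAt (W.baseChange K) p` (additive-p1's `ModelFree.MissingPPartOverCAt`, the
currency of the uniform class theorems `TwistSupplyX4.bsdp_of_classX4M` / `TwistSupply.bsdp_of_classX3M`)
and `Mult Wd p` displayed. Proof: FILE U-1b's θ-model `C_θ • W_K` (`θ² = d_K`) is SOME `K`-model of
`E_K`; J-2's `milneQuotient_ordp_of_tamagawa_anyRank` (model-free) gets its `hT` from U-1b's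
`padicValRat_norm_theta_mul_tamagawaProduct_eq_…`; U-1b's `missingPPartOverAt_theta_smul_iff`
converts `hK`; D-2's `bsdp_of_pPartOver_of_bsdp_twist_ordp` (model-free) descends.

* `bsdp_of_pPartOverC_baseChange_of_bsdp_twist_noMilne_of_addv_unramified_oddPrime_of_dvd_discr` —
  **`BSDp W p ⟸ MissingPPartOverCAt (W.baseChange K) p ∧ BSDp Wd p`** for `[K:ℚ] = 2`, `d_K` odd
  squarefree, `p ∣ d_K` odd, `W_d = C_d • W^{(d_K)}` globally minimal multiplicative at `p`,
  `r_an(W) ≤ 1`, `r_an(W_d) ≤ 1`, H-4b's population `hS`; inputs `hGZK`, `hmod` ONLY;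
* `…_of_natAbs_discr` / `…_of_natAbs_discr_of_potMult` — the canonical field `|d_K| = p`, no local
  hypothesis (H-5c `localHyp_of_natAbs_discr`, H-5d/J-3 `mult_twist_of_potMult_of_natAbs_discr`);
* class currency: `bsdp_of_classX4M_of_bsdp_twist_noMilne_overC_canonical`,
  `bsdp_of_classX3M_of_bsdp_twist_noMilne_overC_canonical` (J-3's class twins, model-free), and the
  rank-zero-twist X4(M) theorem on the GENERAL population
  `bsdp_of_classX4M_of_rankZero_twist_noMilne_overC_of_addv_unramified_oddPrime_of_dvd_discr`
  (Skinner 2016 Thm. C `hSk` discharges `BSDp Wd p`, as in additive-p1's `bsdp_twist_of_rankZero_ram`)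
  — the END that FILE U-4 instantiates on the odd-discriminant twist supply of FILE U-3 to re-issue
  `TwistSupplyRam.bsdp_of_classX4M_of_ram` / `TwistSupplyX4.bsdp_of_classX4M` WITHOUT `hMilneC`.

Compared with additive-p1's `ModelFreeClassTheorems.bsdp_of_pPartOverC_baseChange` (which takes
`hMilneC : Milne1972.bsdQuotient_baseChange_quadratic_anyModel` and `hWd` as an existential), the named
fact `hMilneC` is REPLACED by the population hypotheses `hdodd`, `hdsq`, `hpd`, `hp2`, `hmult`, `hS`
— all of which are theorems on the canonical field (`…_of_natAbs_discr`) and on FILE U-3's twist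
supply (FILE U-4), where the class theorems therefore lose `hMilneC` outright.

HONEST LIMITS: odd `p`, `d_K` odd squarefree with `p ∣ d_K`, `W_d` multiplicative at `p` (so `W`
additive potentially multiplicative at `p`); `BSDp Wd p` displayed unless `r_an(W_d) = 0` ∧ (ram) on
X4(M); X3♯(M)/X4(M) stay CONSTRUCTION-SHAPED (`MissingPPartOverCAt` untouched); closes no class; moves
no mark; 0 facts.

References: T. Dokchitser, V. Dokchitser, Ann. of Math. 172 (2010) §1 Notation, §2.1
[DokchitserDokchitserAnnals2010]; J. S. Milne, Invent. Math. 17 (1972) §1 Thm. 1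
[Milne1972ArithmeticAV]; C. Skinner, Pacific J. Math. 283 (2016) Thm. C [Skinner2016PacificMC];
J. H. Silverman, *ATAEC* V.5.3 [SilvermanATAEC1994]; R. L. Miller, LMS J. Comput. Math. 14 (2011)
Def. 1.1 [Miller2011LMS].
-/

noncomputable section

open scoped Classical NumberField

open WeierstrassCurve NumberField IsDedekindDomain Rat.HeightOneSpectrum
  Literature.NumberTheory.EllipticCurves Literature.NumberTheory.EllipticCurves.Rank1Residual
  Literature.NumberTheory.EllipticCurves.Rank1Residual.Typed
  Literature.NumberTheory.DiophantineGeometry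

namespace Summit.BirchSwinnertonDyer.Rank1Residual.AdditivePotMult

section OverC

variable (W : WeierstrassCurve ℚ) [W.IsElliptic] [W.IsGloballyMinimal] (p : ℕ) [hp : Fact p.Prime]
  (K : Type) [Field K] [NumberField K]
  (Wd : WeierstrassCurve ℚ) [Wd.IsElliptic] [Wd.IsGloballyMinimal]

/-- **THE BASE-CHANGE-AND-DESCEND END IN THE MODEL-FREE CURRENCY, NO MILNE, NO GLOBALLY MINIMAL
`K`-MODEL.** `W/ℚ` globally minimal elliptic of analytic rank `≤ 1`; `[K:ℚ] = 2` with `d_K` odd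
squarefree and `p ∣ d_K`, `p` odd; `W_d = C_d • W^{(d_K)}` globally minimal, MULTIPLICATIVE at `p`, of
analytic rank `≤ 1`; at every place `W` is good ∨ multiplicative ∨ (`ℓ ∣ d_K` ∧ `W_d` multiplicative)
∨ (additive, `ℓ ∤ d_K`, `p = 3 → ℓ ≠ 3`). THEN
**`BSDp W p ⟸ MissingPPartOverCAt (W.baseChange K) p ∧ BSDp Wd p`** (`hGZK`, `hmod`). Proof: the
θ-model `C_θ • W_K`, `C_θ = ⟨θ,0,0,0⟩`, `θ² = d_K` (C-3a `exists_sq_eq_discr`) is a `K`-model of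
`E_K`; its odd Tamagawa identity is FILE U-1b's
`padicValRat_norm_theta_mul_tamagawaProduct_eq_of_addv_unramified_oddPrime_of_dvd_discr`, so J-2's
`milneQuotient_ordp_of_tamagawa_anyRank` gives Milne's binder `hWR_p` for it; U-1b's
`missingPPartOverAt_theta_smul_iff` turns `hK` into Miller's input on the θ-model; D-2's
`bsdp_of_pPartOver_of_bsdp_twist_ordp` descends. [cite: Milne1972ArithmeticAV, §1 Thm. 1 and §2 (through DokchitserDokchitserAnnals2010, §2.1, proof of Thm. 8)]
[cite: DokchitserDokchitserAnnals2010, §1 Notation (arXiv pp. 4–5)]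
[cite: Miller2011LMS, Def. 1.1 (arXiv:1010.2431 p. 3)] -/
theorem bsdp_of_pPartOverC_baseChange_of_bsdp_twist_noMilne_of_addv_unramified_oddPrime_of_dvd_discr
    (hGZK : rank_eq_analyticRank_of_analyticRank_le_one) (hmod : hasEntireLFunction_rat)
    (h2 : Module.finrank ℚ K = 2)
    (hdodd : Odd (NumberField.discr K)) (hdsq : Squarefree (NumberField.discr K))
    (hpd : (p : ℤ) ∣ NumberField.discr K)
    {Cd : VariableChange ℚ} (hWd : Cd • W.quadraticTwist (NumberField.discr K : ℚ) = Wd)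
    (hr : W.analyticRank ≤ 1) (hrd : Wd.analyticRank ≤ 1) (hp2 : p ≠ 2) (hmult : Mult Wd p)
    (hS : ∀ v : HeightOneSpectrum (𝓞 ℚ), W.HasGoodReductionAt v ∨ W.HasMultiplicativeReductionAt v ∨
      (((primesEquiv v : ℕ) : ℤ) ∣ NumberField.discr K ∧ Wd.HasMultiplicativeReductionAt v) ∨
      (W.HasAdditiveReductionAt v ∧ ¬ ((primesEquiv v : ℕ) : ℤ) ∣ NumberField.discr K ∧
        (p = 3 → (primesEquiv v : ℕ) ≠ 3)))
    (hK : MissingPPartOverCAt (W.baseChange K) p) (hd : BSDp Wd p) : BSDp W p := by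
  obtain ⟨-, hfinW⟩ := hGZK W hr
  obtain ⟨-, hfinD⟩ := hGZK Wd hrd
  haveI : Finite W.sha := hfinW
  haveI : Finite Wd.sha := hfinD
  haveI : (W.baseChange K).IsElliptic := by rw [baseChange]; infer_instance
  -- the θ-model
  obtain ⟨θ, hθ0, hθ⟩ := exists_sq_eq_discr h2
  set C' : VariableChange K := ⟨Units.mk0 θ hθ0, 0, 0, 0⟩ with hC'
  have hu : (C'.u : K) = θ := by rw [hC']; exact Units.val_mk0 hθ0
  have hθ' : (C'.u : K) ^ 2 = algebraMap ℚ K (NumberField.discr K : ℚ) := by rw [hu]; exact hθ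
  -- its odd Tamagawa identity (U-1b), Milne's binder for it (J-2), the input conversion (U-1b)
  have hT :=
    padicValRat_norm_theta_mul_tamagawaProduct_eq_of_addv_unramified_oddPrime_of_dvd_discr W K Wd p h2
      hdodd hdsq hpd hWd hp2 hmult hS hθ'
  have hWR := milneQuotient_ordp_of_tamagawa_anyRank W K Wd (C' • W.baseChange K) h2 hWd
    (C' := C') rfl p hp2 hT
  have hK' : MissingPPartOverAt (C' • W.baseChange K) p :=
    (missingPPartOverAt_theta_smul_iff W Wd h2 hdsq p hp2 hpd hWd hmult C' hθ').mpr hK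
  -- descend (D-2, model-free)
  exact bsdp_of_pPartOver_of_bsdp_twist_ordp W p K Wd (C' • W.baseChange K) hGZK hmod hr h2 ⟨Cd, hWd⟩
    hrd ⟨C', rfl⟩ hWR hK' hd

/-- **THE MODEL-FREE END FOR THE CANONICAL FIELD `|d_K| = p`, NO LOCAL HYPOTHESIS**: `[K:ℚ] = 2` with
`|d_K| = p` odd, `W_d = C_d • W^{(d_K)}` globally minimal MULTIPLICATIVE at `p`:
`BSDp W p ⟸ MissingPPartOverCAt (W.baseChange K) p ∧ BSDp Wd p` (`hGZK`, `hmod`) — `hS`, `hdodd`,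
`hdsq` by H-5c's `localHyp_of_natAbs_discr`. [cite: Milne1972ArithmeticAV, §1 Thm. 1 and §2 (through DokchitserDokchitserAnnals2010, §2.1, proof of Thm. 8)]
[cite: DokchitserDokchitserAnnals2010, §1 Notation (arXiv pp. 4–5)] -/
theorem bsdp_of_pPartOverC_baseChange_of_bsdp_twist_noMilne_of_natAbs_discr
    (hGZK : rank_eq_analyticRank_of_analyticRank_le_one) (hmod : hasEntireLFunction_rat)
    (h2 : Module.finrank ℚ K = 2) (hdK : (NumberField.discr K).natAbs = p)
    {Cd : VariableChange ℚ} (hWd : Cd • W.quadraticTwist (NumberField.discr K : ℚ) = Wd)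
    (hr : W.analyticRank ≤ 1) (hrd : Wd.analyticRank ≤ 1) (hp2 : p ≠ 2) (hmult : Mult Wd p)
    (hK : MissingPPartOverCAt (W.baseChange K) p) (hd : BSDp Wd p) : BSDp W p := by
  obtain ⟨hdodd, hdsq, hS⟩ := localHyp_of_natAbs_discr W p K Wd hdK hp2 hmult
  have hpd : (p : ℤ) ∣ NumberField.discr K := Int.natCast_dvd.mpr (by rw [hdK])
  exact bsdp_of_pPartOverC_baseChange_of_bsdp_twist_noMilne_of_addv_unramified_oddPrime_of_dvd_discr W
    p K Wd hGZK hmod h2 hdodd hdsq hpd hWd hr hrd hp2 hmult hS hK hd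

/-- **The model-free END for the canonical field with `Mult Wd p` DISCHARGED from `PotMult W p`**
(J-3's `mult_twist_of_potMult_of_natAbs_discr`, Silverman *ATAEC* V.5.3).
[cite: SilvermanATAEC1994, V.5.3]
[cite: Milne1972ArithmeticAV, §1 Thm. 1 and §2 (through DokchitserDokchitserAnnals2010, §2.1, proof of Thm. 8)] -/
theorem bsdp_of_pPartOverC_baseChange_of_bsdp_twist_noMilne_of_natAbs_discr_of_potMult
    (hGZK : rank_eq_analyticRank_of_analyticRank_le_one) (hmod : hasEntireLFunction_rat)
    (h2 : Module.finrank ℚ K = 2) (hdK : (NumberField.discr K).natAbs = p)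
    {Cd : VariableChange ℚ} (hWd : Cd • W.quadraticTwist (NumberField.discr K : ℚ) = Wd)
    (hr : W.analyticRank ≤ 1) (hrd : Wd.analyticRank ≤ 1) (hp2 : p ≠ 2) (hpm : PotMult W p)
    (hK : MissingPPartOverCAt (W.baseChange K) p) (hd : BSDp Wd p) : BSDp W p :=
  bsdp_of_pPartOverC_baseChange_of_bsdp_twist_noMilne_of_natAbs_discr W p K Wd hGZK hmod h2 hdK hWd hr
    hrd hp2 (mult_twist_of_potMult_of_natAbs_discr W p K Wd hpm hp2 h2 hdK hWd) hK hd

/-- **X4(M) WITH THE CANONICAL FIELD AND A TWIST OF ANALYTIC RANK `≤ 1`, MODEL-FREE: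
`BSD(E, p) ⇐ MissingPPartOverCAt(E ⊗ K, p) ∧ BSD(E^{(p*)}, p)`** (J-3's class twin with the
`K`-model binder gone): inputs `hGZK`, `hmod` and the two displayed hypotheses only.
[cite: SilvermanATAEC1994, V.5.3]
[cite: Milne1972ArithmeticAV, §1 Thm. 1 and §2 (through DokchitserDokchitserAnnals2010, §2.1, proof of Thm. 8)] -/
theorem bsdp_of_classX4M_of_bsdp_twist_noMilne_overC_canonical
    (hGZK : rank_eq_analyticRank_of_analyticRank_le_one) (hmod : hasEntireLFunction_rat)
    (hX : ClassX4M W p) (hr : W.analyticRank ≤ 1) (h2 : Module.finrank ℚ K = 2)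
    (hdK : (NumberField.discr K).natAbs = p)
    {Cd : VariableChange ℚ} (hWd : Cd • W.quadraticTwist (NumberField.discr K : ℚ) = Wd)
    (hrd : Wd.analyticRank ≤ 1) (hK : MissingPPartOverCAt (W.baseChange K) p) (hd : BSDp Wd p) :
    BSDp W p :=
  bsdp_of_pPartOverC_baseChange_of_bsdp_twist_noMilne_of_natAbs_discr_of_potMult W p K Wd hGZK hmod h2
    hdK hWd hr hrd hX.p_ne_two (ClassX4M.potMult W p hX) hK hd

/-- **X3♯(M) WITH THE CANONICAL FIELD AND A TWIST OF ANALYTIC RANK `≤ 1`, MODEL-FREE** (the FULL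
`hd : BSDp Wd p` displayed). [cite: SilvermanATAEC1994, V.5.3]
[cite: Milne1972ArithmeticAV, §1 Thm. 1 and §2 (through DokchitserDokchitserAnnals2010, §2.1, proof of Thm. 8)] -/
theorem bsdp_of_classX3M_of_bsdp_twist_noMilne_overC_canonical
    (hGZK : rank_eq_analyticRank_of_analyticRank_le_one) (hmod : hasEntireLFunction_rat)
    (hX : ClassX3M W p) (hr : W.analyticRank ≤ 1) (h2 : Module.finrank ℚ K = 2)
    (hdK : (NumberField.discr K).natAbs = p)
    {Cd : VariableChange ℚ} (hWd : Cd • W.quadraticTwist (NumberField.discr K : ℚ) = Wd)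
    (hrd : Wd.analyticRank ≤ 1) (hK : MissingPPartOverCAt (W.baseChange K) p) (hd : BSDp Wd p) :
    BSDp W p :=
  bsdp_of_pPartOverC_baseChange_of_bsdp_twist_noMilne_of_natAbs_discr_of_potMult W p K Wd hGZK hmod h2
    hdK hWd hr hrd (ClassX3M.p_ne_two W p hX) (ClassX3M.potMult W p hX) hK hd

/-- **X4(M)⁰ ON THE GENERAL POPULATION, MODEL-FREE, NO MILNE: `BSD(E, p) ⇐ MissingPPartOverCAt(E ⊗ K,
p)` ALONE** for `(E,p) ∈ X4(M)` of analytic rank `≤ 1` and a quadratic `K` with `d_K` odd squarefree,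
`p ∣ d_K`, whose twist `W_d = C_d • W^{(d_K)}` (globally minimal) is MULTIPLICATIVE at `p`, satisfies
(ram), and has analytic rank `0`, `W` on H-4b's population `hS`: the twist is COVERED by Skinner 2016
Thm. C (`hSk`; additive-p1's `bsdp_twist_of_rankZero_ram`, irreducibility transported by
`mult_irr_twist_of_classX4M`), the rest is the first theorem of this file. This is the END that FILE
U-4 instantiates on the odd-discriminant twist supply (FILE U-3) to re-issue additive-p1's
`bsdp_of_classX4M_of_ram` / `bsdp_of_classX4M` WITHOUT `hMilneC`.
[cite: Skinner2016PacificMC, Thm. C (§1), footnote 1, §2.5]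
[cite: Milne1972ArithmeticAV, §1 Thm. 1 and §2 (through DokchitserDokchitserAnnals2010, §2.1, proof of Thm. 8)] -/
theorem bsdp_of_classX4M_of_rankZero_twist_noMilne_overC_of_addv_unramified_oddPrime_of_dvd_discr
    (hGZK : rank_eq_analyticRank_of_analyticRank_le_one) (hmod : hasEntireLFunction_rat)
    (hSk : Skinner2016.thmC_padicValRat_bsd_rank_zero)
    (hX : ClassX4M W p) (hr : W.analyticRank ≤ 1) (h2 : Module.finrank ℚ K = 2)
    (hdodd : Odd (NumberField.discr K)) (hdsq : Squarefree (NumberField.discr K))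
    (hpd : (p : ℤ) ∣ NumberField.discr K)
    {Cd : VariableChange ℚ} (hWd : Cd • W.quadraticTwist (NumberField.discr K : ℚ) = Wd)
    (hmult : Mult Wd p) (hram : Ram Wd p) (hr0 : Wd.analyticRank = 0)
    (hS : ∀ v : HeightOneSpectrum (𝓞 ℚ), W.HasGoodReductionAt v ∨ W.HasMultiplicativeReductionAt v ∨
      (((primesEquiv v : ℕ) : ℤ) ∣ NumberField.discr K ∧ Wd.HasMultiplicativeReductionAt v) ∨
      (W.HasAdditiveReductionAt v ∧ ¬ ((primesEquiv v : ℕ) : ℤ) ∣ NumberField.discr K ∧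
        (p = 3 → (primesEquiv v : ℕ) ≠ 3)))
    (hK : MissingPPartOverCAt (W.baseChange K) p) : BSDp W p := by
  have hD : (NumberField.discr K : ℚ) ≠ 0 := by exact_mod_cast NumberField.discr_ne_zero K
  obtain ⟨hp2, -, hirrd⟩ := mult_irr_twist_of_classX4M hX hD ⟨Cd, hWd⟩ hmult
  have hd : BSDp Wd p := bsdp_twist_of_rankZero_ram p Wd hSk hGZK hmod hp2 hmult hirrd hram hr0
  exact bsdp_of_pPartOverC_baseChange_of_bsdp_twist_noMilne_of_addv_unramified_oddPrime_of_dvd_discr W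
    p K Wd hGZK hmod h2 hdodd hdsq hpd hWd hr (by rw [hr0]; exact zero_le_one) hp2 hmult hS hK hd

end OverC

end Summit.BirchSwinnertonDyer.Rank1Residual.AdditivePotMult

end
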